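import Literature.AlgebraicGeometry.Motives.Varieties
import Mathlib.AlgebraicGeometry.Morphisms.Finite
import Mathlib.AlgebraicGeometry.Morphisms.Etale
import Mathlib.FieldTheory.Perfect
import HarnessLib

/-!
# Kedlaya's étale covers of affine space: finite maps to `ℙⁿ` étale off one hyperplane (named fact)

Topic `Literature/AlgebraicGeometry/Resolution`. Named fact (sorry-free `def … : Prop`, users take
`(h : Kedlaya2004_finite_etale_off_hyperplane)`), vendored for route
`ResolutionOfSingularities/CleanCovers`: it grounds
`Summit.ResolutionOfSingularities.ResolutionOfSingularities.Theses.CleanCovers.KedlayaReduction`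
(item `stmt-ResolutionOfSingularities-15241`, the "Kedlaya normal form" step: every integral
projective variety over a perfect field of characteristic `p` is a finite cover of `ℙⁿ` étale over
the standard affine chart), and is the printed source of the hypothesis shape of
`…CleanCovers.CoverResolution` (item `stmt-ResolutionOfSingularities-15104`).

## Source

K. S. Kedlaya, *More étale covers of affine spaces in positive characteristic*, J. Algebraic
Geom. 14 (2005) 187–192 (arXiv:math/0303382), **Theorem 1** (p. 1 of the arXiv text, verbatim):
"Let `X` be a geometrically reduced, projective variety of pure dimension `n` over a field `k` of
characteristic `p > 0`. Let `𝓛` be an ample line bundle of `X`, let `D` be a closed subscheme of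
`X` of dimension less than `n`, and let `S` be a zero-dimensional subscheme of the smooth locus of
`X` not meeting `D`. Then there exists a finite morphism `f : X → ℙⁿ_k` of `k`-schemes satisfying
the following conditions: (a) `f` is induced by an `(n+1)`-tuple of sections of some tensor power
of `𝓛`; (b) `f` is étale away from the hyperplane `H ⊆ ℙⁿ` at infinity; (c) `f(D) ⊆ H`;
(d) `f(S)` does not meet `H`."  In the proof (last paragraph of the proof of Thm 1): "That is,
`f` is étale over the complement of the hyperplane `u₀ = 0`, and `D` maps into this hyperplane but
no point of `S` does."

## Transcription (a SPECIALISATION of Theorem 1; item = fact ∘ normalisation ∘ projective reduction)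

Mathlib has no ample line bundles / sections-induced morphisms yet, so the fact is vendored in the
specialised, dimension-free form the route consumes, which Theorem 1 implies by standard facts:
* Input: a field `k` of characteristic `p` which is PERFECT, an INTEGRAL scheme `X` and a FINITE
  morphism `g : X → ℙᴺ_k` (so `X` is a projective `k`-scheme — finite morphisms are projective and
  `ℙᴺ_k` is projective, EGA II 6.1.11 + 5.5.5 (ii) — with the ample line bundle `𝓛 := g^*𝒪(1)`,
  EGA II 5.1.12 / Stacks 0892; `X` integral over a perfect field is geometrically reduced and,
  being irreducible, of pure dimension `n := dim X`).  Take `D :=` the non-smooth locus of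
  `X → Spec k` (closed, of dimension `< n` because an integral scheme of finite type over a
  perfect field is generically smooth) and `S := ∅`.
* Output: clause (a) is DROPPED (weaker conclusion); clause (b) is stated as
  `Etale (f ∣_ D₊(xₙ))` — `f` restricted over the standard chart `D₊(xₙ) = ℙⁿ ∖ V₊(xₙ)` is étale —
  after the linear change of coordinates of `ℙⁿ_k` moving Kedlaya's hyperplane at infinity
  `u₀ = 0` to `V₊(xₙ)` (composition with an automorphism of `ℙⁿ_k` preserves finiteness and
  `k`-linearity); clause (c) is dropped (it is implied: a point étale over `𝔸ⁿ` is smooth over `k`);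
  clause (d) is void for `S = ∅`.  `f` is a `k`-morphism (printed: "of `k`-schemes"), recorded as
  `f ≫ (ℙⁿ_k → Spec k) = g ≫ (ℙᴺ_k → Spec k)`.  Surjectivity of `f` is added explicitly: it follows
  from the printed statement since `f` is finite (closed) and `dim X = n = dim ℙⁿ_k` with `ℙⁿ_k`
  irreducible.
* `n` is existentially quantified (it is `dim X`); `ℙⁿ_k` is
  `Literature.AlgebraicGeometry.Motives.projectiveSpace n k = Proj k[x₀,…,xₙ]` over `Spec k`, the
  object used by the summit's route file, and `D₊(xₙ)` is Mathlib's `Proj.basicOpen _ (X (Fin.last n))`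
  exactly as in the items `CoverResolution` / `KedlayaReduction`.
-/

noncomputable section

open CategoryTheory

namespace Literature.AlgebraicGeometry.Resolution

universe u

/-- **Kedlaya 2004, Theorem 1 (finite covers of `ℙⁿ` étale off one hyperplane), specialised to
integral schemes finite over a projective space over a perfect field** (Kedlaya, J. Algebraic Geom.
14 (2005), Thm 1: "Let `X` be a geometrically reduced, projective variety of pure dimension `n`
over a field `k` of characteristic `p > 0`. Let `𝓛` be an ample line bundle of `X`, let `D` be a
closed subscheme of `X` of dimension less than `n` … Then there exists a finite morphism
`f : X → ℙⁿ_k` of `k`-schemes … (b) `f` is étale away from the hyperplane `H ⊆ ℙⁿ` at infinity;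
(c) `f(D) ⊆ H` …"; applied with `𝓛 = g^*𝒪(1)`, `D` = the non-smooth locus, `S = ∅`, coordinates
chosen so that `H = V₊(xₙ)`; clause (a) dropped, surjectivity of `f` spelled out — see the module
docstring). For every prime `p`, perfect field `k` of characteristic `p`, every integral scheme `X`
with a finite morphism `g : X → ℙᴺ_k`, there are `n` and a finite surjective `k`-morphism
`f : X → ℙⁿ_k` whose restriction over the chart `D₊(xₙ) ≅ 𝔸ⁿ_k` is étale. Grounds
`Summit.ResolutionOfSingularities.ResolutionOfSingularities.Theses.CleanCovers.KedlayaReduction`.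
[cite: Kedlaya2004, Thm 1] -/
def Kedlaya2004_finite_etale_off_hyperplane : Prop :=
  ∀ (p : ℕ), p.Prime → ∀ (k : Type u) [Field k] [CharP k p] [PerfectField k] (N : ℕ)
    (X : _root_.AlgebraicGeometry.Scheme.{u}) (g : X ⟶ (Motives.projectiveSpace N k).left),
    _root_.AlgebraicGeometry.IsIntegral X → _root_.AlgebraicGeometry.IsFinite g →
    ∃ (n : ℕ) (f : X ⟶ (Motives.projectiveSpace n k).left),
      f ≫ (Motives.projectiveSpace n k).hom = g ≫ (Motives.projectiveSpace N k).hom ∧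
      _root_.AlgebraicGeometry.IsFinite f ∧ Function.Surjective f.base ∧
      (letI := MvPolynomial.gradedAlgebra (σ := Fin (n + 1)) (R := k)
       _root_.AlgebraicGeometry.Etale (f ∣_ (_root_.AlgebraicGeometry.Proj.basicOpen
         (MvPolynomial.homogeneousSubmodule (Fin (n + 1)) k) (MvPolynomial.X (Fin.last n)))))

end Literature.AlgebraicGeometry.Resolution

end
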